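import Summits.QuantumFields.YangMills.Theorems.BalabanUVNodesN08AlphaEq324RowClassSocketApprox
import Literature.MathematicalPhysics.QuantumFieldTheory.Balaban1983to89.B1Eq324BenfattoClassEntryFromCovarianceUniform

/-!
# Route «BalabanUVNodes», Track-A DAG node N08 = [Balaban1985UV3] Thm 1 p. 257 ∕ Thm 2 p. 272 — THE CLASS ROAD ∘ THE (α)-SOCKET, END TO END, IN THE COVARIANCE's OWN CURRENCY: the
# (3.24) row `h324` of the edited clauses for EVERY a.e. presentation of the step's fluctuation block by the Gaussian field of a uniformly elliptic, bounded, exponentially decaying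
# COVARIANCE on a finite window of `ℤ^d` — [Balaban1985UV3] p. 261 «a covariance having an exponential decay property» — with a (4.5)-type Hamiltonian of `O(g_k^σ)` coefficients:
# the covariance-side class (3.24) theorem `…ClassEntryFromCovarianceUniform.eq324_covariance_of_expDecay` (seat n08-w5 gen 3, p638114) composed with part 4's post-consumer plug
# `…RowClassSocketApprox.h324Row_freeLetter_of_postConsumer_ae` (seat n08-w4 gen 5, p636897) — the covariance-currency twin of n08-w4's precision-currency
# `…RowClassSocketEnd.exists_h324Row_freeLetter_of_expDecayPresentation_ae` (p638143)

Cell `pub-ymgap`, width seat `pub-ymgap-dag-n08-w5` gen 4 (CLAIM-1∕INTENT-1).  `bears_on: R4∕N08`; filed `--supports stmt-QuantumFields-27364` (K1⁹, helper).  THEOREMS ONLY (def-free,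
sorry-free, standard axioms); `eq324_covariance_of_expDecay` (over n08-b's `…KernelEq324AnyGamma.eq324_kernel_of_expDecay` p636283 ∕ n08-d's `eq324_kernel_noPad` p635433 ∕ n08-c's
`classBasicLemma_signed` ∕ the whole `…KernelSect5*` road, entered through the covariance door `…ClassEntryFromCovariance(Uniform)`) and `h324Row_freeLetter_of_postConsumer_ae` consumed BY NAME.

WHY THIS MODULE.  Print presents the step's fluctuation measure `dμ_{C^{(k)}(Ω_{k+1},U_{k+1})}` by its COVARIANCE `C^{(k)}` and records of it exactly three things: it is a Gaussian
covariance on the unit-lattice variables of the step (positivity), it is bounded uniformly in the background, and it has «an exponential decay property» ((22)–(24) pp. 261–262; the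
bounds are the [Balaban1985BackgroundPropagators] in-edge of node N06).  The precision-currency END of n08-w4 asks the presenting member for a symmetric `γ_A`-coercive PRECISION with
entrywise decay `|A e e'| ≤ K_A e^{−κ_A|e−e'|₂}`; an instantiation arriving with covariance-side letters would first have to invert.  This file does that inversion once and for all at
the class level (it is the Combes–Thomas content of seat n08-w5's `…ClassEntryFromCovariance`, already in the tree): the member is presented by a COVARIANCE `G h U` on the window
`Λ h U` — symmetric, `g`-coercive (`g·|x|² ≤ ⟨x,Gx⟩`, uniform ellipticity from below), `Λ_G`-bounded (`⟨x,Gx⟩ ≤ Λ_G|x|²`), `|G e e'| ≤ K_G e^{−κ_G|e−e'|₂}` — and the field is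
`gaussianFieldOfKernel (K h U)` with `K h U` THE ZERO-EXTENSION OF `G h U` ITSELF (no inverse in the hypotheses).

WHAT IS PROVED.  ★★★★ `exists_h324Row_freeLetter_of_covDecayPresentation_ae`: fix a group model, a constants record `𝔠`, a lattice dimension `d ≥ 1`, class scalars `g > 0`, `Λ_G > 0`,
`K_G ≥ 0`, `κ_G > 0` (ellipticity ∕ bound ∕ decay of the presenting covariances), Hamiltonian shape `(D, ϰ > 0)`, threshold parameters `b₀ > 0`, `p₀ > 2∕3`, coupling power `σ > 0` with
`6 + 2κ₀ < σ(n̄ + 1)` and `c₀ ≥ 0`.  THEN `∃ η₀ ∈ (0, 1]`, `C ≥ 0` — functions of these scalars ALONE — such that for EVERY lattice approximation `S`, tower data `𝔖`, step `k` with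
`g_k ≤ η₀` and volume factor `v` with `C·v ≤ Ca + Cc`: whenever the step's fluctuation block is presented, per `(h, U)`, by a finite window `Λ h U ⊂ ℤ^d` (non-empty), a covariance
`G h U` on it as above, its zero-extension `K h U`, a measurable `Φ h U` with `(𝔖 k).μ = (gaussianFieldOfKernel (K h U)).map (Φ h U)`,
`(Φ h U)⁻¹'((𝔖 k).box h) =ᵐ smallFieldSet (I h U) (p(g_k))`, `(𝔖 k).𝒱 h U ∘ Φ h U =ᵐ hamiltonian s D ϰ (a h U) (J h U)`, `∅ ≠ I h U ⊇ J h U`, `J h U ⊆ Λ h U`, `coefSup ≤ c₀·g_k^σ`,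
`|I h U| ≤ v·|T₁^{(k)}|` — the row
`∀ h U, Eq324 (∫ ω in (𝔖 k).box h, e^{(𝔖 k).𝒱 h U ω} ∂(𝔖 k).μ) (n ↦ cumulantOf (m ↦ ∫ ((𝔖 k).𝒱 h U ω)^m ∂(𝔖 k).μ) n) 𝔠.nbar (𝔠.Ca + 𝔠.Cc) (Lᵏ·S.g0sq) (3 + 𝔠.κ₀) (S.sites k)` holds —
`StepAlphaEq324CoreLTAtAC.h324` ∕ `StepAlphaEq324CoreLTAt.h324` at the free letter, character for character (the conclusion of n08-w4's precision-currency END VERBATIM).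
`…_rec_one`: the record's own `b₀ = 𝔠.b₀`, `p₀ = 𝔠.p₀`, print's coupling power `σ = 1`, `5 + 2κ₀ < n̄`.
So the [B1] (3.24) row of N08's (α) clause on the road of record is REDUCED TO THE IDENT in print's own currency: naming, per `(h, U)`, the window ∕ covariance ∕ embedding ∕ cut-off set ∕
Hamiltonian letters of [B10]'s `dμ_{C^{(k)}}(Ω_{k+1}, U_{k+1})`, `χ_k`, `𝒱_k` ((22)∕(24) pp. 261–262, (58) p. 270) with the three covariance bounds uniform in `(h, U, k, S)` — NODE 00 objects;
N06 [B9] in-edges for `(g, Λ_G, K_G, κ_G)`; CHECK C (torus) via part 4 ∕ seat n08-b's bent window where a wrapped region occurs.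
HONEST SCOPE.  A composition by name; every hypothesis above is a HYPOTHESIS; the IDENT is NOT commissioned and NOT claimed; nothing of [Balaban1985UV3] ∕ [BenfattoEtAl1978] ∕
[Balaban1985BackgroundPropagators] asserted or discharged (the class form of [2]'s Lemma is OURS and PROVED in the tree); `PrintedUV3V` NOT proved; N08 NOT discharged; count-neutral; one
finite 𝕋⁴ programme at fixed ε, d = 3 tori of [B10] inside the record, Bałaban AS PRINTED — R4 closes the conditional finite-𝕋⁴ rung `BalabanLadder.UV` only; nothing about d = 4 continuum
limits, OS axioms, a mass gap or the Clay problem.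

References: [Balaban1985UV3] T. Bałaban, CMP 102 (1985) 255–275 — (22)–(24) pp.261–262, (41) p.266, (56)–(58) p.270; [Balaban1982Higgs1] T. Bałaban, CMP 85 (1982) — (3.24) p.616;
[BenfattoEtAl1978] G. Benfatto et al., CMP 59 (1978) — Lemma p.152, Appendix C (C.2)–(C.6) p.164; [Balaban1985BackgroundPropagators] T. Bałaban, CMP 99 (1985) 389–434 — (1.16)–(1.18) p.180, Sect. E p.428.
-/

noncomputable section

namespace Summit.QuantumFields.YangMills.Theorems.BalabanUVNodesN08AlphaEq324RowClassSocketEndCov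

open MeasureTheory
open scoped BigOperators Nat
open Literature.MathematicalPhysics.QuantumFieldTheory (gaussianFieldOfKernel)
open Literature.MathematicalPhysics.QuantumFieldTheory.Balaban1983to89
open Literature.MathematicalPhysics.QuantumFieldTheory.Balaban1983to89.B1Sect3Statements (Eq324)
open Literature.MathematicalPhysics.QuantumFieldTheory.Balaban1983to89.B1Eq324BenfattoLemma (Coef hamiltonian coefSup smallFieldSet cutoffBoltzmann cumulantSum)
open Literature.MathematicalPhysics.QuantumFieldTheory.Balaban1983to89.B1Eq324BenfattoClassEntryFromCovarianceUniform (eq324_covariance_of_expDecay)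
open Literature.MathematicalPhysics.QuantumFieldTheory.Balaban1985CMP102.Setting
open Summit.QuantumFields.Balaban3D.Carriers
open Summit.QuantumFields.Balaban3D.Proofs.ScalesArithmetic (gk_pos)
open Summit.QuantumFields.Balaban3D.Proofs.Primitives (AlphaConsts)
open Summit.QuantumFields.Balaban3D.Proofs.GroupModelLieC (lieC)
open Summit.QuantumFields.YangMills.Theorems.BalabanUVNodesN08AlphaEq324RowClassSocketApprox (h324Row_freeLetter_of_postConsumer_ae)
open Literature.Probability.LatticeModels (cumulantOf)

variable {L : ℕ} {G : Type} [GaugeGroup G] [MeasurableSpace G] [HaarData G] (𝔊 : GroupModel G) (𝔠 : AlphaConsts L 𝔊.N) {d : ℕ}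

/-- ★★★★ **THE (3.24) ROW OF THE EDITED (α) CLAUSES FOR EVERY A.E. PRESENTATION OF THE STEP BLOCK BY A UNIFORMLY ELLIPTIC, BOUNDED, EXPONENTIALLY DECAYING GAUSSIAN COVARIANCE**
(the class road's covariance-side `eq324_covariance_of_expDecay` ∘ the socket's `h324Row_freeLetter_of_postConsumer_ae`; statement in the module docstring).  `η₀, C` depend only on
`(d, g, Λ_G, K_G, κ_G, D, ϰ, b₀, p₀, σ, c₀, n̄, κ₀)`; everything about the member, the embedding, the cut-off set and the Hamiltonian letters may depend on `(h, U)`.  The field's kernel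
`K h U` is the zero-extension of the covariance `Cv h U` itself.
[cite: Balaban1985UV3, (22)–(24) pp.261–262 («a covariance having an exponential decay property») + (41) p.266 + (58) p.270; Balaban1982Higgs1, (3.24) p.616; BenfattoEtAl1978, Lemma p.152, Appendix C (C.2)–(C.6) p.164 (class form; ours); Balaban1985BackgroundPropagators, (1.16)–(1.18) p.180, Sect. E p.428] -/
theorem exists_h324Row_freeLetter_of_covDecayPresentation_ae (hd : 0 < d) {g ΛG KG κG : ℝ} (hg0 : 0 < g) (hΛG0 : 0 < ΛG) (hKG : 0 ≤ KG) (hκG : 0 < κG)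
    (D : ℕ) {ϰ : ℝ} (hϰ : 0 < ϰ) {b₀ p₀ σ c₀ : ℝ} (hb₀ : 0 < b₀) (hp₀ : 2 / 3 < p₀) (hσ : 0 < σ) (hc₀ : 0 ≤ c₀) (hκσ : 6 + 2 * 𝔠.κ₀ < σ * (𝔠.nbar + 1)) :
    ∃ η₀ C : ℝ, 0 < η₀ ∧ η₀ ≤ 1 ∧ 0 ≤ C ∧
      ∀ (S : Scales L) (𝔖 : ∀ k, StepSeries S G ↥(lieC 𝔊) (nblkOf S 𝔠.lane.carrier k) k) (k : ℕ) (v : ℝ),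
        S.gk k ≤ η₀ → C * v ≤ 𝔠.Ca + 𝔠.Cc →
        ∀ (Λ : Hist S.P (k + 1) → GaugeField S.P (k + 1) G → Finset (Fin d → ℤ))
          (Cv : ∀ h U, Matrix ↥(Λ h U) ↥(Λ h U) ℝ) (K : Hist S.P (k + 1) → GaugeField S.P (k + 1) G → (Fin d → ℤ) → (Fin d → ℤ) → ℝ)
          (Φ : Hist S.P (k + 1) → GaugeField S.P (k + 1) G → ((Fin d → ℤ) → ℝ) → (𝔖 k).Fl)
          (s : ℕ) (I J : Hist S.P (k + 1) → GaugeField S.P (k + 1) G → Finset (Fin d → ℤ))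
          (a : Hist S.P (k + 1) → GaugeField S.P (k + 1) G → Coef d),
          -- the members (covariance currency: the kernel IS the covariance, zero-extended)
          (∀ h U x y, K h U x y = if hxy : x ∈ Λ h U ∧ y ∈ Λ h U then Cv h U ⟨x, hxy.1⟩ ⟨y, hxy.2⟩ else 0) →
          (∀ h U, (Λ h U).Nonempty) → (∀ h U e e', Cv h U e e' = Cv h U e' e) →
          (∀ h U (x : ↥(Λ h U) → ℝ), g * ∑ e, x e ^ 2 ≤ ∑ e, ∑ e', Cv h U e e' * x e * x e') →
          (∀ h U (x : ↥(Λ h U) → ℝ), ∑ e, ∑ e', Cv h U e e' * x e * x e' ≤ ΛG * ∑ e, x e ^ 2) →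
          (∀ h U (e e' : ↥(Λ h U)), |Cv h U e e'| ≤ KG * Real.exp (-(κG * Real.sqrt (∑ j, ((((e : Fin d → ℤ) j : ℝ) - ((e' : Fin d → ℤ) j : ℝ))) ^ 2)))) →
          -- the a.e. presentation
          (∀ h U, Measurable (Φ h U)) → (∀ h U, (𝔖 k).μ = (gaussianFieldOfKernel (K h U)).map (Φ h U)) →
          (∀ h, MeasurableSet ((𝔖 k).box h)) → (∀ h U, Measurable ((𝔖 k).𝒱 h U)) →
          (∀ h U, Φ h U ⁻¹' (𝔖 k).box h =ᵐ[gaussianFieldOfKernel (K h U)] smallFieldSet (I h U) (B10.pFun b₀ p₀ (S.gk k))) →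
          (∀ h U, (fun z => (𝔖 k).𝒱 h U (Φ h U z)) =ᵐ[gaussianFieldOfKernel (K h U)] hamiltonian s D ϰ (a h U) (J h U)) →
          -- the instance data
          (∀ h U, (I h U).Nonempty) → (∀ h U, J h U ⊆ I h U) → (∀ h U, J h U ⊆ Λ h U) →
          (∀ h U, coefSup s D (a h U) (J h U) ≤ c₀ * S.gk k ^ σ) → (∀ h U, ((I h U).card : ℝ) ≤ v * S.sites k) →
          ∀ h (U : GaugeField S.P (k + 1) G),
            Eq324 (∫ ω in (𝔖 k).box h, Real.exp ((𝔖 k).𝒱 h U ω) ∂(𝔖 k).μ)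
              (fun n => cumulantOf (fun m => ∫ ω, (𝔖 k).𝒱 h U ω ^ m ∂(𝔖 k).μ) n) 𝔠.nbar (𝔠.Ca + 𝔠.Cc)
              ((L : ℝ) ^ k * S.g0sq) (3 + 𝔠.κ₀) (S.sites k) := by
  obtain ⟨η₀, C, hη₀, hη₀1, hC, hE⟩ :=
    eq324_covariance_of_expDecay (d := d) hd hg0 hΛG0 hKG hκG 𝔠.nbar D hϰ hb₀ hp₀ hσ hc₀ (κ := 6 + 2 * 𝔠.κ₀) (by linarith [𝔠.κ₀_pos]) hκσ
  refine ⟨η₀, C, hη₀, hη₀1, hC, ?_⟩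
  intro S 𝔖 k v hgk hCv Λ Cv K Φ s I J a hK hΛ hGs hg hΛG hdec hΦ hμ hboxm hVm hbox hV hI hJI hJΛ hA hIv
  refine h324Row_freeLetter_of_postConsumer_ae 𝔊 𝔠 𝔖 k hC hCv (fun h U => gaussianFieldOfKernel (K h U)) Φ hΦ hμ hboxm hVm I hbox
    (fun h U => hamiltonian s D ϰ (a h U) (J h U)) hV hIv fun h U => ?_
  exact hE (S.gk k) (gk_pos S k) hgk (hK h U) (hΛ h U) (hGs h U) (hg h U) (hΛG h U) (hdec h U) s (I h U) (J h U) (a h U) (hI h U) (hJI h U)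
    (hJΛ h U) (hA h U)

/-- **… AT THE RECORD's OWN `b₀ = 𝔠.b₀`, `p₀ = 𝔠.p₀` AND PRINT's COUPLING POWER `σ = 1`** (coefficients `O(g_k)`, (56)–(57); `5 + 2κ₀ < n̄`, so `n̄ = 6`), covariance currency.
[cite: Balaban1985UV3, (7) p.257 + (22)–(24) pp.261–262 + (56)–(58) p.270; Balaban1982Higgs1, (3.24) p.616; BenfattoEtAl1978, Lemma p.152 (class form; ours)] -/
theorem exists_h324Row_freeLetter_of_covDecayPresentation_ae_rec_one (hd : 0 < d) {g ΛG KG κG : ℝ} (hg0 : 0 < g) (hΛG0 : 0 < ΛG) (hKG : 0 ≤ KG)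
    (hκG : 0 < κG) (D : ℕ) {ϰ : ℝ} (hϰ : 0 < ϰ) {c₀ : ℝ} (hc₀ : 0 ≤ c₀) (hn : 5 + 2 * 𝔠.κ₀ < 𝔠.nbar) :
    ∃ η₀ C : ℝ, 0 < η₀ ∧ η₀ ≤ 1 ∧ 0 ≤ C ∧
      ∀ (S : Scales L) (𝔖 : ∀ k, StepSeries S G ↥(lieC 𝔊) (nblkOf S 𝔠.lane.carrier k) k) (k : ℕ) (v : ℝ),
        S.gk k ≤ η₀ → C * v ≤ 𝔠.Ca + 𝔠.Cc →
        ∀ (Λ : Hist S.P (k + 1) → GaugeField S.P (k + 1) G → Finset (Fin d → ℤ))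
          (Cv : ∀ h U, Matrix ↥(Λ h U) ↥(Λ h U) ℝ) (K : Hist S.P (k + 1) → GaugeField S.P (k + 1) G → (Fin d → ℤ) → (Fin d → ℤ) → ℝ)
          (Φ : Hist S.P (k + 1) → GaugeField S.P (k + 1) G → ((Fin d → ℤ) → ℝ) → (𝔖 k).Fl)
          (s : ℕ) (I J : Hist S.P (k + 1) → GaugeField S.P (k + 1) G → Finset (Fin d → ℤ))
          (a : Hist S.P (k + 1) → GaugeField S.P (k + 1) G → Coef d),
          (∀ h U x y, K h U x y = if hxy : x ∈ Λ h U ∧ y ∈ Λ h U then Cv h U ⟨x, hxy.1⟩ ⟨y, hxy.2⟩ else 0) →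
          (∀ h U, (Λ h U).Nonempty) → (∀ h U e e', Cv h U e e' = Cv h U e' e) →
          (∀ h U (x : ↥(Λ h U) → ℝ), g * ∑ e, x e ^ 2 ≤ ∑ e, ∑ e', Cv h U e e' * x e * x e') →
          (∀ h U (x : ↥(Λ h U) → ℝ), ∑ e, ∑ e', Cv h U e e' * x e * x e' ≤ ΛG * ∑ e, x e ^ 2) →
          (∀ h U (e e' : ↥(Λ h U)), |Cv h U e e'| ≤ KG * Real.exp (-(κG * Real.sqrt (∑ j, ((((e : Fin d → ℤ) j : ℝ) - ((e' : Fin d → ℤ) j : ℝ))) ^ 2)))) →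
          (∀ h U, Measurable (Φ h U)) → (∀ h U, (𝔖 k).μ = (gaussianFieldOfKernel (K h U)).map (Φ h U)) →
          (∀ h, MeasurableSet ((𝔖 k).box h)) → (∀ h U, Measurable ((𝔖 k).𝒱 h U)) →
          (∀ h U, Φ h U ⁻¹' (𝔖 k).box h =ᵐ[gaussianFieldOfKernel (K h U)] smallFieldSet (I h U) (B10.pFun 𝔠.b₀ 𝔠.p₀ (S.gk k))) →
          (∀ h U, (fun z => (𝔖 k).𝒱 h U (Φ h U z)) =ᵐ[gaussianFieldOfKernel (K h U)] hamiltonian s D ϰ (a h U) (J h U)) →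
          (∀ h U, (I h U).Nonempty) → (∀ h U, J h U ⊆ I h U) → (∀ h U, J h U ⊆ Λ h U) →
          (∀ h U, coefSup s D (a h U) (J h U) ≤ c₀ * S.gk k) → (∀ h U, ((I h U).card : ℝ) ≤ v * S.sites k) →
          ∀ h (U : GaugeField S.P (k + 1) G),
            Eq324 (∫ ω in (𝔖 k).box h, Real.exp ((𝔖 k).𝒱 h U ω) ∂(𝔖 k).μ)
              (fun n => cumulantOf (fun m => ∫ ω, (𝔖 k).𝒱 h U ω ^ m ∂(𝔖 k).μ) n) 𝔠.nbar (𝔠.Ca + 𝔠.Cc)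
              ((L : ℝ) ^ k * S.g0sq) (3 + 𝔠.κ₀) (S.sites k) := by
  obtain ⟨η₀, C, hη₀, hη₀1, hC, h⟩ :=
    exists_h324Row_freeLetter_of_covDecayPresentation_ae 𝔊 𝔠 (d := d) hd hg0 hΛG0 hKG hκG D hϰ (b₀ := 𝔠.b₀) (p₀ := 𝔠.p₀) (σ := 1)
      𝔠.b₀_pos (by linarith [𝔠.two_lt_p₀]) one_pos hc₀ (by linarith)
  refine ⟨η₀, C, hη₀, hη₀1, hC, ?_⟩
  intro S 𝔖 k v hgk hCv Λ Cv K Φ s I J a hK hΛ hGs hg hΛG hdec hΦ hμ hboxm hVm hbox hV hI hJI hJΛ hA hIv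
  exact h S 𝔖 k v hgk hCv Λ Cv K Φ s I J a hK hΛ hGs hg hΛG hdec hΦ hμ hboxm hVm hbox hV hI hJI hJΛ
    (fun h' U => by rw [Real.rpow_one]; exact hA h' U) hIv

end Summit.QuantumFields.YangMills.Theorems.BalabanUVNodesN08AlphaEq324RowClassSocketEndCov

end
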